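import Mathlib
import Literature.NumberTheory.LFunctions.WeilExplicit
import Summits.RiemannHypothesis.RiemannHypothesis.Theorems.WeilParityOffLineParityDetectionStubEvenOffLineCauchySchwarz
import HarnessLib

/-!
# Crux `OffLineParityDetection`, line `registered`: stub BOHR (recurrence transfer of top-heaviness)

Route `WeilParity`, crux
`Summit.RiemannHypothesis.RiemannHypothesis.Theses.WeilParity.OffLineParityDetection`
(item stmt-RiemannHypothesis-15431), line `registered`.  This file proves the registered stub
`stub_bohrTransfer` BY NAME, with the registered signature (RH-free, `ζ`-free).

Setting: a finite "top layer" `T` of points `ρ` with `Re ρ = 1/2 + η₀` (`η₀ > 0`), weights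
`w ≥ 0` on `T`, the Laplace transforms `F_f(ρ) = ∫_{u>0} f(u) e^{-(ρ-1/2)u} du` of smooth compactly
supported real profiles `f` on `[0, ∞)`, the energy `‖f‖² = ∫_{u>0} f²` and the phase form
`gain(a, f) = Σ_{ρ∈T} w(ρ) Re(e^{2i(Im ρ)a} F_f(ρ)²)`.  If at ONE phase point `a₀` every profile's
danger `-gain(a₀, f)` is `≤ D‖f‖²` and a fixed profile `f₀` gains `≥ (D + δ)‖f₀‖²`, then the same
holds (with `D' = D + δ/4` and margin `δ/2`) at frequently many `a → ∞`.

## Proof (all elementary)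

* MODULUS BOUND (`norm_sq_laplace_le`): for `ρ ∈ T` and `u > 0`,
  `‖f(u) e^{-(ρ-1/2)u}‖ = |f(u)| e^{-η₀u}`, so by Cauchy–Schwarz on `(0, ∞)` (the tree lemma
  `sq_integral_mul_le`) `‖F_f(ρ)‖² ≤ ‖f‖² ∫₀^∞ e^{-2η₀u} du = ‖f‖²/(2η₀)`.
* PHASE PERTURBATION (`abs_gain_sub_le`): `|Re(e^{iθ}z) - Re(e^{iθ'}z)| ≤ ‖e^{iθ} - e^{iθ'}‖ ‖z‖`,
  hence `|gain(a₀ + τ, f) - gain(a₀, f)| ≤ ε Σ_ρ w(ρ) ‖F_f(ρ)‖² ≤ ε (Σ w)/(2η₀) · ‖f‖²` as soon as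
  `‖e^{2i(Im ρ)τ} - 1‖ ≤ ε` for all `ρ ∈ T`.
* RECURRENCE (`frequently_atTop_phases_near_one`, pure compactness, no number theory): for finitely
  many real frequencies `x_ρ` and every `ε > 0` the set of `τ` with `‖e^{i x_ρ τ} - 1‖ ≤ ε` for all
  `ρ` is unbounded above — the sequence `n ↦ (e^{i x_ρ n})_ρ` lives in the compact product of closed
  unit discs, so a subsequence `φ` converges (Bolzano–Weierstrass, `IsCompact.tendsto_subseq`), and
  the differences `τ = φ(l) - φ(K)` (`l ≥ K` large) work, since
  `‖e^{i x τ} - 1‖ = ‖e^{i x φ(l)} - e^{i x φ(K)}‖` and `φ(l) ≥ l → ∞`.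
* ASSEMBLY (`bohrTransfer_abstract`, stated for an abstract transform `F`, energy `N` and profile
  class `P` with `‖F f ρ‖² ≤ C · N f`): choose `ε` with `ε C (Σ w) ≤ δ/4`, put `a = a₀ + τ`,
  `D' = D + δ/4`.

Nothing about `ζ`, Weil tests or the explicit formula is used or stated here.
-/

-- the problem directory `RiemannHypothesis/RiemannHypothesis` fixes the namespace (gate convention)
set_option linter.dupNamespace false

noncomputable section

open MeasureTheory Set Filter
open scoped ComplexConjugate Topology

namespace Summit.RiemannHypothesis.RiemannHypothesis.Theorems.WeilParityOffLineParityDetection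

open Literature.NumberTheory.LFunctions

/-! ## Unimodular phases -/

/-- `‖e^{is} - e^{it}‖ = ‖e^{i(s-t)} - 1‖` for real `s, t` (divide by the unit `e^{it}`).
[folklore] -/
theorem norm_cexp_ofReal_mul_I_sub (s t : ℝ) :
    ‖Complex.exp ((s : ℂ) * Complex.I) - Complex.exp ((t : ℂ) * Complex.I)‖ =
      ‖Complex.exp (((s - t : ℝ) : ℂ) * Complex.I) - 1‖ := by
  have h : Complex.exp ((s : ℂ) * Complex.I) =
      Complex.exp ((t : ℂ) * Complex.I) * Complex.exp (((s - t : ℝ) : ℂ) * Complex.I) := by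
    rw [← Complex.exp_add]
    congr 1
    push_cast
    ring
  rw [h, ← mul_sub_one, norm_mul, Complex.norm_exp_ofReal_mul_I, one_mul]

/-- The phase factor `e^{2iγa}` (`γ, a` real) is unimodular. [folklore] -/
theorem norm_cexp_two_mul_mul_I (γ a : ℝ) :
    ‖Complex.exp (2 * (γ : ℂ) * (a : ℂ) * Complex.I)‖ = 1 := by
  have h : 2 * (γ : ℂ) * (a : ℂ) * Complex.I = ((2 * γ * a : ℝ) : ℂ) * Complex.I := by
    push_cast
    ring
  rw [h, Complex.norm_exp_ofReal_mul_I]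

/-- Additivity of the phase: `e^{2iγ(a+τ)} = e^{2iγa} e^{2iγτ}`. [folklore] -/
theorem cexp_two_mul_mul_add_mul_I (γ a τ : ℝ) :
    Complex.exp (2 * (γ : ℂ) * ((a + τ : ℝ) : ℂ) * Complex.I) =
      Complex.exp (2 * (γ : ℂ) * (a : ℂ) * Complex.I) *
        Complex.exp (2 * (γ : ℂ) * (τ : ℂ) * Complex.I) := by
  rw [← Complex.exp_add]
  congr 1
  push_cast
  ring

/-! ## Recurrence of finitely many phases (compactness of the torus) -/

/-- **Simultaneous recurrence of finitely many phases.**  For a finite set `T`, real frequencies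
`x ρ` (`ρ ∈ T`) and `ε > 0`, the set of `τ` with `‖e^{i x_ρ τ} - 1‖ ≤ ε` for every `ρ ∈ T` is
unbounded above (`∃ᶠ τ in atTop`).  Proof by Bolzano–Weierstrass in the compact product of closed
unit discs: a subsequence `φ` of `n ↦ (e^{i x_ρ n})_ρ` converges, and `τ = φ(K+N) - φ(K)` works for
`K` large, with `φ(K+N) ≥ K+N`. [folklore] -/
theorem frequently_atTop_phases_near_one (T : Finset ℂ) (x : ℂ → ℝ) {ε : ℝ} (hε : 0 < ε) :
    ∃ᶠ τ : ℝ in atTop, ∀ ρ ∈ T, ‖Complex.exp (((x ρ * τ : ℝ) : ℂ) * Complex.I) - 1‖ ≤ ε := by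
  have hK : IsCompact (Set.pi Set.univ fun _ : ↥T ↦ Metric.closedBall (0 : ℂ) 1) :=
    isCompact_univ_pi fun _ ↦ isCompact_closedBall (0 : ℂ) 1
  have hmem : ∀ n : ℕ, (fun ρ : ↥T ↦ Complex.exp ((((x ρ) * n : ℝ) : ℂ) * Complex.I)) ∈
      Set.pi Set.univ fun _ : ↥T ↦ Metric.closedBall (0 : ℂ) 1 := by
    intro n
    simp only [Set.mem_pi, Set.mem_univ, true_implies, Metric.mem_closedBall, dist_zero_right]
    intro ρ
    exact (Complex.norm_exp_ofReal_mul_I _).le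
  obtain ⟨L, -, φ, hφ, hlim⟩ := hK.tendsto_subseq hmem
  rw [tendsto_pi_nhds] at hlim
  have hev : ∀ᶠ k in atTop, ∀ ρ : ↥T,
      dist (((fun (n : ℕ) (ρ : ↥T) ↦ Complex.exp ((((x ρ) * n : ℝ) : ℂ) * Complex.I)) ∘ φ) k ρ)
        (L ρ) < ε / 2 :=
    eventually_all.2 fun ρ ↦ Metric.tendsto_nhds.1 (hlim ρ) (ε / 2) (half_pos hε)
  obtain ⟨K, hK'⟩ := eventually_atTop.1 hev
  refine frequently_atTop.2 fun A ↦ ?_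
  obtain ⟨N, hN⟩ := exists_nat_ge (A + φ K)
  refine ⟨(φ (K + N) : ℝ) - (φ K : ℝ), ?_, fun ρ hρ ↦ ?_⟩
  · have h1 : ((K + N : ℕ) : ℝ) ≤ (φ (K + N) : ℝ) := Nat.cast_le.mpr hφ.le_apply
    have h2 : (N : ℝ) ≤ ((K + N : ℕ) : ℝ) := Nat.cast_le.mpr (Nat.le_add_left N K)
    linarith
  · have hl := hK' (K + N) (Nat.le_add_right K N) ⟨ρ, hρ⟩
    have hk := hK' K le_rfl ⟨ρ, hρ⟩
    have hd : dist (((fun (n : ℕ) (ρ : ↥T) ↦ Complex.exp ((((x ρ) * n : ℝ) : ℂ) * Complex.I)) ∘ φ)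
        (K + N) ⟨ρ, hρ⟩) (((fun (n : ℕ) (ρ : ↥T) ↦
          Complex.exp ((((x ρ) * n : ℝ) : ℂ) * Complex.I)) ∘ φ) K ⟨ρ, hρ⟩) < ε :=
      calc _ ≤ _ := dist_triangle_right _ _ (L ⟨ρ, hρ⟩)
        _ < ε / 2 + ε / 2 := add_lt_add hl hk
        _ = ε := add_halves ε
    rw [dist_eq_norm] at hd
    simp only [Function.comp_apply] at hd
    rw [norm_cexp_ofReal_mul_I_sub] at hd
    rw [mul_sub]
    exact hd.le

/-! ## Phase perturbation of the gain form -/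

/-- One term: `|Re(e^{2iγ(a+τ)} z) - Re(e^{2iγa} z)| ≤ ‖e^{2iγτ} - 1‖ ‖z‖`. [folklore] -/
theorem abs_re_phase_sub_le (γ a τ : ℝ) (z : ℂ) :
    |(Complex.exp (2 * (γ : ℂ) * ((a + τ : ℝ) : ℂ) * Complex.I) * z).re -
        (Complex.exp (2 * (γ : ℂ) * (a : ℂ) * Complex.I) * z).re| ≤
      ‖Complex.exp (2 * (γ : ℂ) * (τ : ℂ) * Complex.I) - 1‖ * ‖z‖ := by
  rw [← Complex.sub_re, cexp_two_mul_mul_add_mul_I, ← sub_mul, ← mul_sub_one]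
  refine (Complex.abs_re_le_norm _).trans (le_of_eq ?_)
  rw [norm_mul, norm_mul, norm_cexp_two_mul_mul_I, one_mul]

/-- The whole form: if all phases `e^{2i(Im ρ)τ}`, `ρ ∈ T`, are within `ε` of `1` and `w ≥ 0`, then
`|gain(a + τ) - gain(a)| ≤ ε Σ_ρ w(ρ) ‖G ρ‖²`. [folklore] -/
theorem abs_gain_sub_le (T : Finset ℂ) (w : ℂ → ℝ) (hw : ∀ ρ ∈ T, 0 ≤ w ρ) (G : ℂ → ℂ)
    (a τ ε : ℝ) (hτ : ∀ ρ ∈ T, ‖Complex.exp (2 * (ρ.im : ℂ) * (τ : ℂ) * Complex.I) - 1‖ ≤ ε) :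
    |∑ ρ ∈ T, w ρ * (Complex.exp (2 * (ρ.im : ℂ) * ((a + τ : ℝ) : ℂ) * Complex.I) * G ρ ^ 2).re -
        ∑ ρ ∈ T, w ρ * (Complex.exp (2 * (ρ.im : ℂ) * (a : ℂ) * Complex.I) * G ρ ^ 2).re| ≤
      ε * ∑ ρ ∈ T, w ρ * ‖G ρ‖ ^ 2 := by
  rw [← Finset.sum_sub_distrib, Finset.mul_sum]
  refine (Finset.abs_sum_le_sum_abs _ _).trans (Finset.sum_le_sum fun ρ hρ ↦ ?_)
  rw [← mul_sub, abs_mul, abs_of_nonneg (hw ρ hρ)]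
  calc w ρ * |(Complex.exp (2 * (ρ.im : ℂ) * ((a + τ : ℝ) : ℂ) * Complex.I) * G ρ ^ 2).re -
          (Complex.exp (2 * (ρ.im : ℂ) * (a : ℂ) * Complex.I) * G ρ ^ 2).re|
        ≤ w ρ * (‖Complex.exp (2 * (ρ.im : ℂ) * (τ : ℂ) * Complex.I) - 1‖ * ‖G ρ ^ 2‖) :=
          mul_le_mul_of_nonneg_left (abs_re_phase_sub_le _ _ _ _) (hw ρ hρ)
    _ ≤ w ρ * (ε * ‖G ρ ^ 2‖) :=
          mul_le_mul_of_nonneg_left (mul_le_mul_of_nonneg_right (hτ ρ hρ) (norm_nonneg _))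
            (hw ρ hρ)
    _ = ε * (w ρ * ‖G ρ‖ ^ 2) := by rw [norm_pow]; ring

/-! ## The modulus bound for the Laplace transform on the top layer -/

/-- **Modulus bound.**  For a continuous compactly supported real `f`, `η₀ > 0` and
`Re ρ = 1/2 + η₀`: `‖∫_{u>0} f(u) e^{-(ρ-1/2)u} du‖² ≤ ‖f‖²/(2η₀)` with `‖f‖² = ∫_{u>0} f²`
(`|e^{-(ρ-1/2)u}| = e^{-η₀u}`, Cauchy–Schwarz, `∫₀^∞ e^{-2η₀u} du = 1/(2η₀)`). [folklore] -/
theorem norm_sq_laplace_le {f : ℝ → ℝ} (hf : Continuous f) (hs : HasCompactSupport f) {η₀ : ℝ}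
    (hη₀ : 0 < η₀) {ρ : ℂ} (hρ : ρ.re = 1 / 2 + η₀) :
    ‖∫ u in Set.Ioi (0 : ℝ), (f u : ℂ) * Complex.exp (-((ρ - 1 / 2) * (u : ℂ)))‖ ^ 2 ≤
      1 / (2 * η₀) * ∫ u in Set.Ioi (0 : ℝ), f u ^ 2 := by
  have hre : ∀ u : ℝ, (-((ρ - 1 / 2) * (u : ℂ))).re = -η₀ * u := by
    intro u
    simp [Complex.mul_re, hρ]
  have hnorm : ∀ u : ℝ, ‖(f u : ℂ) * Complex.exp (-((ρ - 1 / 2) * (u : ℂ)))‖ =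
      ‖f u‖ * Real.exp (-η₀ * u) := by
    intro u
    rw [norm_mul, Complex.norm_real, Complex.norm_exp, hre u]
  have hint : ‖∫ u in Set.Ioi (0 : ℝ), (f u : ℂ) * Complex.exp (-((ρ - 1 / 2) * (u : ℂ)))‖ ≤
      ∫ u in Set.Ioi (0 : ℝ), ‖f u‖ * Real.exp (-η₀ * u) := by
    calc _ ≤ ∫ u in Set.Ioi (0 : ℝ), ‖(f u : ℂ) * Complex.exp (-((ρ - 1 / 2) * (u : ℂ)))‖ :=
          norm_integral_le_integral_norm _
      _ = _ := by simp_rw [hnorm]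
  have hexp2 : ∀ u : ℝ, Real.exp (-η₀ * u) ^ 2 = Real.exp (-(2 * η₀) * u) := by
    intro u
    rw [sq, ← Real.exp_add]
    congr 1
    ring
  have hff : Integrable (fun u ↦ f u * f u) := (hf.mul hf).integrable_of_hasCompactSupport hs.mul_right
  have hf2 : Integrable (fun u ↦ ‖f u‖ ^ 2) (volume.restrict (Set.Ioi (0 : ℝ))) := by
    have e : (fun u ↦ ‖f u‖ ^ 2) = fun u ↦ f u * f u :=
      funext fun u ↦ by rw [Real.norm_eq_abs, sq_abs, sq]
    rw [e]
    exact hff.integrableOn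
  have hk : Integrable (fun u ↦ Real.exp (-η₀ * u) ^ 2) (volume.restrict (Set.Ioi (0 : ℝ))) := by
    simp_rw [hexp2]
    exact integrableOn_exp_mul_Ioi (by linarith) 0
  have huk : Integrable (fun u ↦ ‖f u‖ * Real.exp (-η₀ * u))
      (volume.restrict (Set.Ioi (0 : ℝ))) :=
    ((hf.norm.mul (by fun_prop)).integrable_of_hasCompactSupport hs.norm.mul_right).integrableOn
  have hk_val : ∫ u in Set.Ioi (0 : ℝ), Real.exp (-η₀ * u) ^ 2 = 1 / (2 * η₀) := by
    simp_rw [hexp2]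
    rw [integral_exp_mul_Ioi (by linarith) 0, mul_zero, Real.exp_zero, neg_div_neg_eq]
  calc ‖∫ u in Set.Ioi (0 : ℝ), (f u : ℂ) * Complex.exp (-((ρ - 1 / 2) * (u : ℂ)))‖ ^ 2
      ≤ (∫ u in Set.Ioi (0 : ℝ), ‖f u‖ * Real.exp (-η₀ * u)) ^ 2 :=
        pow_le_pow_left₀ (norm_nonneg _) hint 2
    _ ≤ (∫ u in Set.Ioi (0 : ℝ), ‖f u‖ ^ 2) * ∫ u in Set.Ioi (0 : ℝ), Real.exp (-η₀ * u) ^ 2 :=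
        sq_integral_mul_le hf2 hk huk
    _ = 1 / (2 * η₀) * ∫ u in Set.Ioi (0 : ℝ), f u ^ 2 := by
        rw [hk_val, mul_comm]
        simp_rw [Real.norm_eq_abs, sq_abs]

/-! ## The abstract transfer -/

/-- **Abstract BOHR transfer.**  Let `F f ρ` be any "transform", `N f ≥ 0` any "energy" and `P`
any class of profiles with the modulus bound `‖F f ρ‖² ≤ C · N f` on `T` (`C ≥ 0`, `w ≥ 0`).  If at
the phase point `a₀` every `P`-profile has danger `-gain(a₀, f) ≤ D · N f` and `f₀ ∈ P` gains
`≥ (D + δ) N f₀` (`δ > 0`, `D ≥ 0`), then frequently as `a → ∞` there is `D' ≥ 0` (namely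
`D + δ/4`) with danger `≤ D' · N f` for every `P`-profile and gain of `f₀` `≥ (D' + δ/2) N f₀`.
Here `gain(a, f) = Σ_{ρ∈T} w(ρ) Re(e^{2i(Im ρ)a} (F f ρ)²)`. [folklore] -/
theorem bohrTransfer_abstract (T : Finset ℂ) (w : ℂ → ℝ) (hw : ∀ ρ ∈ T, 0 ≤ w ρ)
    (P : (ℝ → ℝ) → Prop) (F : (ℝ → ℝ) → ℂ → ℂ) (N : (ℝ → ℝ) → ℝ) (C : ℝ) (hC : 0 ≤ C)
    (hN : ∀ f, P f → 0 ≤ N f) (hFN : ∀ f, P f → ∀ ρ ∈ T, ‖F f ρ‖ ^ 2 ≤ C * N f)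
    (a₀ δ D : ℝ) (hδ : 0 < δ) (hD : 0 ≤ D)
    (hdanger : ∀ f, P f →
      -(∑ ρ ∈ T, w ρ * (Complex.exp (2 * (ρ.im : ℂ) * (a₀ : ℂ) * Complex.I) * F f ρ ^ 2).re) ≤
        D * N f)
    (f₀ : ℝ → ℝ) (hf₀ : P f₀)
    (hgain : (D + δ) * N f₀ ≤
      ∑ ρ ∈ T, w ρ * (Complex.exp (2 * (ρ.im : ℂ) * (a₀ : ℂ) * Complex.I) * F f₀ ρ ^ 2).re) :
    ∃ᶠ a : ℝ in atTop, ∃ D' : ℝ, 0 ≤ D' ∧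
      (∀ f, P f →
        -(∑ ρ ∈ T, w ρ * (Complex.exp (2 * (ρ.im : ℂ) * (a : ℂ) * Complex.I) * F f ρ ^ 2).re) ≤
          D' * N f) ∧
      (D' + δ / 2) * N f₀ ≤
        ∑ ρ ∈ T, w ρ * (Complex.exp (2 * (ρ.im : ℂ) * (a : ℂ) * Complex.I) * F f₀ ρ ^ 2).re := by
  set S := ∑ ρ ∈ T, w ρ with hS
  have hS0 : 0 ≤ S := Finset.sum_nonneg hw
  have hCS : 0 ≤ C * S := mul_nonneg hC hS0
  -- the tolerance `ε` on the phases
  obtain ⟨ε, hε0, hεCS⟩ : ∃ ε : ℝ, 0 < ε ∧ ε * (C * S) ≤ δ / 4 := by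
    refine ⟨δ / (4 * (C * S + 1)), by positivity, ?_⟩
    have hne : C * S + 1 ≠ 0 := by positivity
    calc δ / (4 * (C * S + 1)) * (C * S) ≤ δ / (4 * (C * S + 1)) * (C * S + 1) :=
          mul_le_mul_of_nonneg_left (by linarith) (by positivity)
      _ = δ / 4 := by field_simp
  -- perturbation: for a good `τ`, every profile's gain moves by at most `δ/4 · N f`
  have hpert : ∀ τ : ℝ,
      (∀ ρ ∈ T, ‖Complex.exp (2 * (ρ.im : ℂ) * (τ : ℂ) * Complex.I) - 1‖ ≤ ε) → ∀ f, P f →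
        |∑ ρ ∈ T, w ρ * (Complex.exp (2 * (ρ.im : ℂ) * ((a₀ + τ : ℝ) : ℂ) * Complex.I) *
              F f ρ ^ 2).re -
            ∑ ρ ∈ T, w ρ * (Complex.exp (2 * (ρ.im : ℂ) * (a₀ : ℂ) * Complex.I) *
              F f ρ ^ 2).re| ≤
          δ / 4 * N f := by
    intro τ hτ f hf
    refine (abs_gain_sub_le T w hw (F f) a₀ τ ε hτ).trans ?_
    have h1 : ∑ ρ ∈ T, w ρ * ‖F f ρ‖ ^ 2 ≤ ∑ ρ ∈ T, w ρ * (C * N f) :=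
      Finset.sum_le_sum fun ρ hρ ↦ mul_le_mul_of_nonneg_left (hFN f hf ρ hρ) (hw ρ hρ)
    have h2 : ∑ ρ ∈ T, w ρ * (C * N f) = C * S * N f := by
      rw [← Finset.sum_mul, ← hS]
      ring
    calc ε * ∑ ρ ∈ T, w ρ * ‖F f ρ‖ ^ 2 ≤ ε * (C * S * N f) := by
          rw [← h2]
          exact mul_le_mul_of_nonneg_left h1 hε0.le
      _ = ε * (C * S) * N f := by ring
      _ ≤ δ / 4 * N f := mul_le_mul_of_nonneg_right hεCS (hN f hf)
  -- recurrence of the phases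
  have hrec : ∃ᶠ τ : ℝ in atTop,
      ∀ ρ ∈ T, ‖Complex.exp (2 * (ρ.im : ℂ) * (τ : ℂ) * Complex.I) - 1‖ ≤ ε := by
    refine (frequently_atTop_phases_near_one T (fun ρ ↦ 2 * ρ.im) hε0).mono fun τ hτ ρ hρ ↦ ?_
    have h : ‖Complex.exp (((2 * ρ.im * τ : ℝ) : ℂ) * Complex.I) - 1‖ ≤ ε := hτ ρ hρ
    have e : ((2 * ρ.im * τ : ℝ) : ℂ) * Complex.I = 2 * (ρ.im : ℂ) * (τ : ℂ) * Complex.I := by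
      push_cast
      ring
    rwa [e] at h
  -- assembly along `a = a₀ + τ`
  refine frequently_atTop.2 fun A ↦ ?_
  obtain ⟨τ, hτA, hτ⟩ := frequently_atTop.1 hrec (A - a₀)
  refine ⟨a₀ + τ, by linarith, D + δ / 4, by linarith, fun f hf ↦ ?_, ?_⟩
  · have h := abs_le.1 (hpert τ hτ f hf)
    have hd := hdanger f hf
    linarith [h.1, h.2]
  · have h := abs_le.1 (hpert τ hτ f₀ hf₀)
    linarith [h.1, h.2]

/-! ## The registered stub -/

/-- Stub **BOHR** of crux `OffLineParityDetection` (line `registered`), RH-free and `ζ`-free: if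
at the phase point `a₀` every smooth compactly supported profile `f` on `[0, ∞)` has danger
`-gain(a₀, f) ≤ D ‖f‖²` and the FIXED profile `f₀` gains `≥ (D + δ) ‖f₀‖²`, then frequently along
`a → ∞` every profile's danger is `≤ D' ‖f‖²` and the same `f₀` gains `≥ (D' + δ/2) ‖f₀‖²` for
some `D' ≥ 0`; here `gain(a, f) = Σ_{ρ∈T} w(ρ) Re(e^{2i(Im ρ)a} F_f(ρ)²)`,
`F_f(ρ) = ∫_{u>0} f(u) e^{-(ρ-1/2)u} du`, `‖f‖² = ∫_{u>0} f²`, `T` a finite set of points with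
`Re ρ = 1/2 + η₀`, `η₀ > 0`, `w ≥ 0`.  Proof: `bohrTransfer_abstract` with the modulus bound
`norm_sq_laplace_le` (`C = 1/(2η₀)`). [folklore] -/
theorem stub_bohrTransfer :
    ∀ η₀ : ℝ, 0 < η₀ → ∀ T : Finset ℂ, (∀ ρ ∈ T, ρ.re = 1 / 2 + η₀) →
      ∀ w : ℂ → ℝ, (∀ ρ ∈ T, 0 ≤ w ρ) → ∀ a₀ δ D : ℝ, 0 < δ → 0 ≤ D →
      (∀ f : ℝ → ℝ, ContDiff ℝ (⊤ : ℕ∞) f → HasCompactSupport f → tsupport f ⊆ Set.Ici 0 →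
        -(∑ ρ ∈ T, w ρ * (Complex.exp (2 * (ρ.im : ℂ) * (a₀ : ℂ) * Complex.I) *
            (∫ u in Set.Ioi (0 : ℝ), (f u : ℂ) * Complex.exp (-((ρ - 1 / 2) * (u : ℂ)))) ^ 2).re)
          ≤ D * ∫ u in Set.Ioi (0 : ℝ), f u ^ 2) →
      ∀ f₀ : ℝ → ℝ, ContDiff ℝ (⊤ : ℕ∞) f₀ → HasCompactSupport f₀ → tsupport f₀ ⊆ Set.Ici 0 →
      (D + δ) * ∫ u in Set.Ioi (0 : ℝ), f₀ u ^ 2 ≤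
        ∑ ρ ∈ T, w ρ * (Complex.exp (2 * (ρ.im : ℂ) * (a₀ : ℂ) * Complex.I) *
          (∫ u in Set.Ioi (0 : ℝ), (f₀ u : ℂ) * Complex.exp (-((ρ - 1 / 2) * (u : ℂ)))) ^ 2).re →
      ∃ᶠ a : ℝ in Filter.atTop, ∃ D' : ℝ, 0 ≤ D' ∧
        (∀ f : ℝ → ℝ, ContDiff ℝ (⊤ : ℕ∞) f → HasCompactSupport f → tsupport f ⊆ Set.Ici 0 →
          -(∑ ρ ∈ T, w ρ * (Complex.exp (2 * (ρ.im : ℂ) * (a : ℂ) * Complex.I) *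
              (∫ u in Set.Ioi (0 : ℝ), (f u : ℂ) * Complex.exp (-((ρ - 1 / 2) * (u : ℂ)))) ^ 2).re)
            ≤ D' * ∫ u in Set.Ioi (0 : ℝ), f u ^ 2) ∧
        (D' + δ / 2) * ∫ u in Set.Ioi (0 : ℝ), f₀ u ^ 2 ≤
          ∑ ρ ∈ T, w ρ * (Complex.exp (2 * (ρ.im : ℂ) * (a : ℂ) * Complex.I) *
            (∫ u in Set.Ioi (0 : ℝ), (f₀ u : ℂ) * Complex.exp (-((ρ - 1 / 2) * (u : ℂ)))) ^ 2).re := by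
  intro η₀ hη₀ T hT w hw a₀ δ D hδ hD hdanger f₀ hf₀ hf₀s hf₀t hgain
  have key := bohrTransfer_abstract T w hw
    (fun f ↦ ContDiff ℝ (⊤ : ℕ∞) f ∧ HasCompactSupport f ∧ tsupport f ⊆ Set.Ici 0)
    (fun f ρ ↦ ∫ u in Set.Ioi (0 : ℝ), (f u : ℂ) * Complex.exp (-((ρ - 1 / 2) * (u : ℂ))))
    (fun f ↦ ∫ u in Set.Ioi (0 : ℝ), f u ^ 2) (1 / (2 * η₀)) (by positivity)
    (fun f _ ↦ integral_nonneg fun u ↦ sq_nonneg (f u))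
    (fun f hf ρ hρ ↦ norm_sq_laplace_le hf.1.continuous hf.2.1 hη₀ (hT ρ hρ))
    a₀ δ D hδ hD (fun f hf ↦ hdanger f hf.1 hf.2.1 hf.2.2) f₀ ⟨hf₀, hf₀s, hf₀t⟩ hgain
  refine key.mono fun a ha ↦ ?_
  obtain ⟨D', hD', h1, h2⟩ := ha
  exact ⟨D', hD', fun f hf hs ht ↦ h1 f ⟨hf, hs, ht⟩, h2⟩

end Summit.RiemannHypothesis.RiemannHypothesis.Theorems.WeilParityOffLineParityDetection

end
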